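import Literature.Computability.FineGrained.CompactionMachine
import HarnessLib

/-!
# The clause-width reduction `k`-SAT → 3-SAT (Impagliazzo–Paturi–Zane, Lemma 10), with its machine

Family `fine-grained` (trunk T-CPLX-FINE). Impagliazzo–Paturi–Zane (*Which problems have
strongly exponential complexity?*, JCSS 63 (2001), Lemma 10, p. 525): "for any `k ≥ 3`, `k`-SAT
with parameter `m` strongly many-one reduces to 3-SAT with parameter `m` (and hence also with
parameter `n`)" — every clause `x₁ ∨ … ∨ x_j` is replaced by a chain of width-3 clauses through
fresh variables. This file defines the reduction on the `k`-CNFs of `FineGrainedWave0.lean`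
(`KCNF.toThreeCNF`), proves that it preserves satisfiability (`KCNF.satisfiable_toThreeCNF_iff`)
and is linear in the number of clauses (`KCNF.numVars_toThreeCNF_le`,
`KCNF.length_clauses_toThreeCNF_le`), and PROVES that it is computed from `KCNF.encode` to
`KCNF.encode` by a multi-stack Turing machine in polynomial time (`KCNF.toThreeCNF_computable`,
`100 (L + 1)^3` steps) — the ingredient which, with the tree's proved sparsification lemma, gives
`SETH ⇒ ETH` (`EthOfSeth.lean`).

## The reduction (`KCNF.toThreeCNF`)

Lemma 10 replaces a clause `x₁ ∨ … ∨ x_j` by `x₁ ∨ y₁`, `¬y_{i-1} ∨ x_i ∨ y_i` (`2 ≤ i ≤ j-1`),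
`¬y_{j-1} ∨ x_j` with `j - 1` fresh variables. We use the uniform variant of the same chain with
`j + 1` fresh variables `y_f, …, y_{f+j}` (`f` the first unused index) and the `j + 2` clauses
`¬y_f`, `y_{f+i-1} ∨ x_i ∨ ¬y_{f+i}` (`1 ≤ i ≤ j`), `y_{f+j}` (`KCNF.gadget`): `y_{f+i}` stands
for "one of `x₁, …, x_i` holds", so the gadget is satisfiable over an assignment of the `x`'s iff
the clause is (`KCNF.gadget_sound`, `KCNF.gadgets_complete`). The variant treats every clause —
including empty and unit clauses — by the same left-to-right pass with a running counter and no
look-ahead, which is what the stack program implements; the number of variables of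
`ψ.toThreeCNF` is `n + Σ_c (|c| + 1) ≤ n + (k+1) m` and the number of clauses `Σ_c (|c| + 2)`,
linear in `m`, as in the source.

## The program (`WidthReduction.prog`)

A structured stack program over the alphabet `Γ'` of the encoding
(`Literature.Computability.Complexity.ACom`, `SymbolPrograms.lean`: exact step counts, compiled to
Mathlib's `Turing.FinTM2` by `ACom.exists_computesInTime`) on the register file and with the
routines of the sparsification and compaction programs (`SparsifierRoutines.lean`: the passes
`litPass` / `famPass`, the word encodings `litBody` / `cbody` / `wFam`; `CompactionMachine.lean`:
binary numerals `bits`, the counter increment `incr`, `emitCnt`, `finish`). The input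
`bits n ++ comma :: wFam F` is read once (`hdrBody`): the header digits are collected on `j1`
and, at the comma, poured into the counter register `cnt` (which thus holds `bits n`, the first
fresh variable); then the clauses are processed (`clauseAct` per clause through `famPass`,
`litAct` per literal through `litPass`), the produced clauses accumulating reversed on `acc`, and
`finish` writes counter, comma and clauses to the output register. At a clause `c` with counter
`f`: emit the unit clause `[(f, false)]`; at each literal `l` emit the chain clause
`[(cnt, true), l, (cnt + 1, false)]`, incrementing the counter in between; emit the unit clause
`[(cnt, true)]` and increment once more — exactly `KCNF.gadget f c`, the counter ending at
`f + |c| + 1` (`KCNF.gadgets`, `KCNF.freshAfter`).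

## Proof architecture of the machine

Each routine has a `runs_*` specification (effect on the store as `Function.update`s and a cost:
`cLitAct`, `cClause`, `cProg`); the loops are instances of `runs_litPass` / `runs_famPass` with
the invariants `StL` (a clause body: `acc` holds the chain so far, `cnt` the counter
`f + |done|`) and `StF` (the clause list: `acc` holds `wFam (gadgets n done)`, `cnt` holds
`bits (freshAfter n done)`), using `KCNF.chain_append` / `KCNF.gadgets_append`. Sizes: every
counter value lies in `[n, n + L]`, so its numeral has at most `|bits n| + L ≤ 2 L` digits
(`length_bits_add_le`); all registers stay polynomial in `L` and the total cost is
`cProg L ≤ 100 (L + 1)^3` (`cProg_le`).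

Mathlib has no `k`-SAT or machine toolkit beyond `Turing.TM2ComputableInPolyTime id` (searched
`threeSAT`, `width`, `Tseitin`, `sparsif`: no hits).

## References

* R. Impagliazzo, R. Paturi, F. Zane, *Which problems have strongly exponential complexity?*,
  J. Comput. System Sci. 63 (2001) 512–530, doi:10.1006/jcss.2001.1774, Lemma 10 (p. 525).
  [key `ImpagliazzoPaturiZaneJCSS2001`; read from the authors' copy]
* S. Arora, B. Barak, *Computational Complexity: A Modern Approach*, CUP 2009, §1.3 (multi-tape
  machine constructions). [key `AroraBarak2009`]
* T. Nipkow, G. Klein, *Concrete Semantics with Isabelle/HOL*, Springer 2014, Ch. 7 (reasoning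
  with big-step semantics; the style of the `runs_*` lemmas).
-/

namespace Literature.Computability.FineGrained

open _root_.Computability Turing

namespace KCNF

variable {k : ℕ}

/-! ### The chain gadget of one clause -/

/-- The chain clauses of the clause `c = [x₁, …, x_j]` with fresh variables from `f` on:
`[y_f ∨ x₁ ∨ ¬y_{f+1}, y_{f+1} ∨ x₂ ∨ ¬y_{f+2}, …, y_{f+j-1} ∨ x_j ∨ ¬y_{f+j}]`, i.e.
`y_{f+i} → (y_{f+i-1} ∨ x_i)`. (Variant of Impagliazzo–Paturi–Zane 2001, Lemma 10, see the module
docstring.) [cite: ImpagliazzoPaturiZaneJCSS2001, Lemma 10 (p. 525)] -/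
def chain : ℕ → List (ℕ × Bool) → List (List (ℕ × Bool))
  | _, [] => []
  | f, l :: c => [(f, true), l, (f + 1, false)] :: chain (f + 1) c

/-- The gadget of the clause `c = [x₁, …, x_j]` with fresh variables `y_f, …, y_{f+j}`: the unit
clause `¬y_f`, the chain clauses, and the unit clause `y_{f+j}` — `j + 2` clauses of width `≤ 3`,
equisatisfiable with `c` over the assignments of the `x`'s (`gadget_sound`, `gadgets_complete`).
[cite: ImpagliazzoPaturiZaneJCSS2001, Lemma 10 (p. 525)] -/
def gadget (f : ℕ) (c : List (ℕ × Bool)) : List (List (ℕ × Bool)) :=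
  [(f, false)] :: (chain f c ++ [[(f + c.length, true)]])

/-- The gadgets of a list of clauses, the fresh variables being allocated consecutively from `f`
on (the clause `c` uses `y_f, …, y_{f+|c|}` and the next clause starts at `f + |c| + 1`).
[cite: ImpagliazzoPaturiZaneJCSS2001, Lemma 10 (p. 525)] -/
def gadgets : ℕ → List (List (ℕ × Bool)) → List (List (ℕ × Bool))
  | _, [] => []
  | f, c :: F => gadget f c ++ gadgets (f + c.length + 1) F

/-- The first unused variable index after allocating the fresh variables of the clauses `F`
from `f` on: `f + Σ_{c ∈ F} (|c| + 1)` (`freshAfter_eq`). [folklore] -/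
def freshAfter : ℕ → List (List (ℕ × Bool)) → ℕ
  | f, [] => f
  | f, c :: F => freshAfter (f + c.length + 1) F

/-- `freshAfter` in closed form. [folklore] -/
theorem freshAfter_eq (f : ℕ) (F : List (List (ℕ × Bool))) :
    freshAfter f F = f + (F.map fun c => c.length + 1).sum := by
  induction F generalizing f with
  | nil => simp [freshAfter]
  | cons c F ih => simp [freshAfter, ih]; omega

/-- `freshAfter` does not decrease the counter. [folklore] -/
theorem le_freshAfter (f : ℕ) (F : List (List (ℕ × Bool))) : f ≤ freshAfter f F := by
  rw [freshAfter_eq]; exact Nat.le_add_right _ _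

/-- `freshAfter` over a concatenation. [folklore] -/
theorem freshAfter_append (f : ℕ) (F G : List (List (ℕ × Bool))) :
    freshAfter f (F ++ G) = freshAfter (freshAfter f F) G := by
  induction F generalizing f with
  | nil => rfl
  | cons c F ih => exact ih _

/-- `gadgets` over a concatenation. [folklore] -/
theorem gadgets_append (f : ℕ) (F G : List (List (ℕ × Bool))) :
    gadgets f (F ++ G) = gadgets f F ++ gadgets (freshAfter f F) G := by
  induction F generalizing f with
  | nil => rfl
  | cons c F ih => simp [gadgets, freshAfter, ih]

/-- `chain` over a concatenation. [folklore] -/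
theorem chain_append (f : ℕ) (c d : List (ℕ × Bool)) :
    chain f (c ++ d) = chain f c ++ chain (f + c.length) d := by
  induction c generalizing f with
  | nil => simp [chain]
  | cons l c ih => simp [chain, ih, Nat.add_assoc, Nat.add_comm 1]

/-- The number of chain clauses. [folklore] -/
@[simp] theorem length_chain (f : ℕ) (c : List (ℕ × Bool)) : (chain f c).length = c.length := by
  induction c generalizing f with
  | nil => rfl
  | cons l c ih => simp [chain, ih]

/-- The number of gadget clauses: `|c| + 2`. [folklore] -/
@[simp] theorem length_gadget (f : ℕ) (c : List (ℕ × Bool)) :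
    (gadget f c).length = c.length + 2 := by
  simp [gadget]

/-- The number of clauses of the gadgets: `Σ_{c ∈ F} (|c| + 2)`. [folklore] -/
theorem length_gadgets (f : ℕ) (F : List (List (ℕ × Bool))) :
    (gadgets f F).length = (F.map fun c => c.length + 2).sum := by
  induction F generalizing f with
  | nil => rfl
  | cons c F ih => simp [gadgets, ih]

/-- The literals of a chain clause: one literal of `c`, and fresh literals with indices in
`[f, f + |c|]`; every chain clause has exactly three literals. [folklore] -/
theorem mem_chain {f : ℕ} {c : List (ℕ × Bool)} {d : List (ℕ × Bool)} (hd : d ∈ chain f c) :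
    d.length = 3 ∧ ∀ l ∈ d, l ∈ c ∨ (f ≤ l.1 ∧ l.1 ≤ f + c.length) := by
  induction c generalizing f with
  | nil => simp [chain] at hd
  | cons x c ih =>
    simp only [chain, List.mem_cons] at hd
    rcases hd with rfl | hd
    · refine ⟨rfl, fun l hl => ?_⟩
      simp only [List.mem_cons, List.not_mem_nil, or_false] at hl
      rcases hl with rfl | rfl | rfl
      · exact Or.inr ⟨le_rfl, by simp⟩
      · exact Or.inl List.mem_cons_self
      · exact Or.inr ⟨by simp, by simp⟩
    · obtain ⟨h1, h2⟩ := ih hd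
      refine ⟨h1, fun l hl => ?_⟩
      rcases h2 l hl with h | h
      · exact Or.inl (List.mem_cons_of_mem _ h)
      · exact Or.inr ⟨by omega, by simp only [List.length_cons]; omega⟩

/-- The literals of a gadget clause: literals of `c`, or fresh literals with indices in
`[f, f + |c|]`; every gadget clause has at most three literals. [folklore] -/
theorem mem_gadget {f : ℕ} {c : List (ℕ × Bool)} {d : List (ℕ × Bool)} (hd : d ∈ gadget f c) :
    d.length ≤ 3 ∧ ∀ l ∈ d, l ∈ c ∨ (f ≤ l.1 ∧ l.1 ≤ f + c.length) := by
  simp only [gadget, List.mem_cons, List.mem_append, List.not_mem_nil, or_false] at hd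
  rcases hd with rfl | hd | rfl
  · exact ⟨by simp, fun l hl => by simp at hl; subst hl; exact Or.inr ⟨le_rfl, by simp⟩⟩
  · obtain ⟨h1, h2⟩ := mem_chain hd
    exact ⟨h1.le, h2⟩
  · exact ⟨by simp, fun l hl => by simp at hl; subst hl; exact Or.inr ⟨by simp, le_rfl⟩⟩

/-- The literals of a clause of `gadgets f F`: literals of a clause of `F`, or fresh literals
with indices in `[f, freshAfter f F)`; at most three literals per clause. [folklore] -/
theorem mem_gadgets {f : ℕ} {F : List (List (ℕ × Bool))} {d : List (ℕ × Bool)}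
    (hd : d ∈ gadgets f F) :
    d.length ≤ 3 ∧ ∀ l ∈ d, (∃ c ∈ F, l ∈ c) ∨ (f ≤ l.1 ∧ l.1 < freshAfter f F) := by
  induction F generalizing f with
  | nil => simp [gadgets] at hd
  | cons c F ih =>
    simp only [gadgets, List.mem_append] at hd
    rcases hd with hd | hd
    · obtain ⟨h1, h2⟩ := mem_gadget hd
      refine ⟨h1, fun l hl => ?_⟩
      rcases h2 l hl with h | h
      · exact Or.inl ⟨c, List.mem_cons_self, h⟩
      · refine Or.inr ⟨h.1, ?_⟩
        have := le_freshAfter (f + c.length + 1) F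
        simp only [freshAfter]; omega
    · obtain ⟨h1, h2⟩ := ih hd
      refine ⟨h1, fun l hl => ?_⟩
      rcases h2 l hl with ⟨c', hc', h⟩ | h
      · exact Or.inl ⟨c', List.mem_cons_of_mem _ hc', h⟩
      · exact Or.inr ⟨by omega, by simpa [freshAfter] using h.2⟩

/-! ### The reduction -/

/-- **The width reduction `k`-CNF → 3-CNF** (Impagliazzo–Paturi–Zane 2001, Lemma 10, in the
uniform chain variant of the module docstring): the clauses are replaced by their gadgets, the
fresh variables `y` being numbered consecutively after the `n` original variables, and the number
of variables becomes `n + Σ_c (|c| + 1)`. [cite: ImpagliazzoPaturiZaneJCSS2001, Lemma 10 (p. 525)] -/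
def toThreeCNF (φ : KCNF k) : KCNF 3 where
  numVars := freshAfter φ.numVars φ.clauses
  clauses := gadgets φ.numVars φ.clauses
  fst_lt_numVars d hd l hl := by
    rcases (mem_gadgets hd).2 l hl with ⟨c, hc, hlc⟩ | h
    · exact (φ.fst_lt_numVars c hc l hlc).trans_le (le_freshAfter _ _)
    · exact h.2
  length_le d hd := (mem_gadgets hd).1

/-- The number of variables of the 3-CNF: `n + Σ_c (|c| + 1)`. [folklore] -/
theorem numVars_toThreeCNF (φ : KCNF k) :
    φ.toThreeCNF.numVars = φ.numVars + (φ.clauses.map fun c => c.length + 1).sum :=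
  freshAfter_eq _ _

/-- The clauses of the 3-CNF (definitional). [folklore] -/
theorem clauses_toThreeCNF (φ : KCNF k) :
    φ.toThreeCNF.clauses = gadgets φ.numVars φ.clauses := rfl

/-- The number of variables of the 3-CNF of a `k`-CNF with `m` clauses is at most
`n + (k + 1) m` — linear in the number of clauses, as in the source ("hence also with parameter
`n`" on sparse instances). [cite: ImpagliazzoPaturiZaneJCSS2001, Lemma 10 (p. 525)] -/
theorem numVars_toThreeCNF_le (φ : KCNF k) :
    φ.toThreeCNF.numVars ≤ φ.numVars + (k + 1) * φ.clauses.length := by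
  rw [numVars_toThreeCNF]
  have : (φ.clauses.map fun c => c.length + 1).sum ≤ φ.clauses.length * (k + 1) := by
    have := List.sum_le_card_nsmul (φ.clauses.map fun c => c.length + 1) (k + 1) (by
      intro x hx
      obtain ⟨c, hc, rfl⟩ := List.mem_map.1 hx
      exact Nat.succ_le_succ (φ.length_le c hc))
    simpa using this
  rw [Nat.mul_comm] at this
  omega

/-- The number of clauses of the 3-CNF is at most `(k + 2) m` ("at most `k` times that of the
original formula" for the printed gadget; `|c| + 2 ≤ k + 2` per clause for the variant).
[cite: ImpagliazzoPaturiZaneJCSS2001, Lemma 10 (p. 525)] -/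
theorem length_clauses_toThreeCNF_le (φ : KCNF k) :
    φ.toThreeCNF.clauses.length ≤ (k + 2) * φ.clauses.length := by
  rw [clauses_toThreeCNF, length_gadgets]
  have := List.sum_le_card_nsmul (φ.clauses.map fun c => c.length + 2) (k + 2) (by
    intro x hx
    obtain ⟨c, hc, rfl⟩ := List.mem_map.1 hx
    exact Nat.add_le_add_right (φ.length_le c hc) 2)
  simpa [Nat.mul_comm] using this

/-! ### Equisatisfiability -/

/-- `List.any` only depends on the values of the predicate on the members. [folklore] -/
theorem any_congr_mem {α : Type*} {p q : α → Bool} :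
    ∀ {l : List α}, (∀ a ∈ l, p a = q a) → l.any p = l.any q
  | [], _ => rfl
  | a :: l, h => by
    rw [List.any_cons, List.any_cons, h a List.mem_cons_self,
      any_congr_mem fun b hb => h b (List.mem_cons_of_mem a hb)]

section Semantics

variable (w : ℕ → Bool)

/-- **Soundness of the chain**: if all chain clauses of `c` (from `f`) hold under `w` and
`y_{f+|c|}` is true, then `y_f` is true or some literal of `c` holds. [folklore] -/
theorem chain_sound : ∀ (f : ℕ) (c : List (ℕ × Bool)),
    (∀ d ∈ chain f c, (d.any fun l => w l.1 == l.2) = true) →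
    w (f + c.length) = true → w f = true ∨ (c.any fun l => w l.1 == l.2) = true
  | f, [], _, hf => Or.inl (by simpa using hf)
  | f, x :: c, hch, hf => by
    have h0 : ([(f, true), x, (f + 1, false)].any fun l => w l.1 == l.2) = true :=
      hch _ (by simp [chain])
    have ih := chain_sound (f + 1) c (fun d hd => hch d (by simp [chain, hd]))
      (by simpa [Nat.add_assoc, Nat.add_comm 1] using hf)
    rcases ih with h1 | h1
    · simp only [List.any_cons, List.any_nil, Bool.or_false, Bool.or_eq_true, beq_iff_eq,
        h1] at h0
      rcases h0 with h0 | h0 | h0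
      · exact Or.inl h0
      · exact Or.inr (by simp [h0])
      · exact absurd h0 (by simp)
    · exact Or.inr (by simp [List.any_cons, h1])

/-- **Soundness of the gadget**: if all gadget clauses of `c` hold under `w`, then `c` holds
under `w`. [folklore] -/
theorem gadget_sound (f : ℕ) (c : List (ℕ × Bool))
    (h : ∀ d ∈ gadget f c, (d.any fun l => w l.1 == l.2) = true) :
    (c.any fun l => w l.1 == l.2) = true := by
  have h1 : w f = false := by simpa [gadget] using h [(f, false)] (by simp [gadget])
  have h2 : w (f + c.length) = true := by
    simpa using h [(f + c.length, true)] (by simp [gadget])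
  rcases chain_sound w f c (fun d hd => h d (by simp [gadget, hd])) h2 with h3 | h3
  · rw [h1] at h3; exact absurd h3 (by simp)
  · exact h3

/-- **Soundness of the reduction**: an assignment satisfying all gadgets satisfies all the
original clauses. [folklore] -/
theorem gadgets_sound : ∀ (f : ℕ) (F : List (List (ℕ × Bool))),
    (∀ d ∈ gadgets f F, (d.any fun l => w l.1 == l.2) = true) →
    ∀ c ∈ F, (c.any fun l => w l.1 == l.2) = true
  | _, [], _, c, hc => by simp at hc
  | f, c₀ :: F, h, c, hc => by
    rcases List.mem_cons.1 hc with rfl | hc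
    · exact gadget_sound w f c (fun d hd => h d (by simp [gadgets, hd]))
    · exact gadgets_sound (f + c₀.length + 1) F (fun d hd => h d (by simp [gadgets, hd])) c hc

/-- **Completeness of the chain**: if `y_{f+i} = b ∨ (x₁ ∨ … ∨ x_i)` for `i ≤ |c|` (a Boolean
"carry" `b` and the prefix disjunctions of `c`), then all chain clauses of `c` hold. [folklore] -/
theorem chain_complete : ∀ (f : ℕ) (c : List (ℕ × Bool)) (b : Bool),
    (∀ i ≤ c.length, w (f + i) = (b || (c.take i).any fun l => w l.1 == l.2)) →
    ∀ d ∈ chain f c, (d.any fun l => w l.1 == l.2) = true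
  | _, [], _, _, d, hd => by simp [chain] at hd
  | f, x :: c, b, H, d, hd => by
    simp only [chain, List.mem_cons] at hd
    rcases hd with rfl | hd
    · have hf : w f = b := by simpa using H 0 (Nat.zero_le _)
      have hf1 : w (f + 1) = (b || (w x.1 == x.2)) := by simpa using H 1 (by simp)
      simp only [List.any_cons, List.any_nil, Bool.or_false, hf, hf1]
      cases b <;> cases (w x.1 == x.2) <;> simp
    · refine chain_complete (f + 1) c (b || (w x.1 == x.2)) (fun i hi => ?_) d hd
      have := H (i + 1) (by simpa using hi)
      rw [show f + (i + 1) = f + 1 + i by omega] at this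
      rw [this]
      simp [List.take_succ_cons, Bool.or_assoc]

/-- **Completeness of the reduction**: an assignment `v` satisfying the clauses `F`, all of whose
variables are `< f`, extends (changing only variables `≥ f`) to an assignment satisfying all
gadgets `gadgets f F` — set `y_{g+i} := x₁ ∨ … ∨ x_i` in the gadget of `c = [x₁, …]` starting at
`g`. [folklore] -/
theorem gadgets_complete : ∀ (F : List (List (ℕ × Bool))) (f : ℕ) (v : ℕ → Bool),
    (∀ c ∈ F, ∀ l ∈ c, l.1 < f) → (∀ c ∈ F, (c.any fun l => v l.1 == l.2) = true) →
    ∃ w : ℕ → Bool, (∀ x < f, w x = v x) ∧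
      ∀ d ∈ gadgets f F, (d.any fun l => w l.1 == l.2) = true
  | [], _, v, _, _ => ⟨v, fun _ _ => rfl, fun d hd => by simp [gadgets] at hd⟩
  | c :: F, f, v, hlt, hsat => by
    -- set the fresh variables of the gadget of `c`
    set v' : ℕ → Bool := fun x =>
      if f ≤ x ∧ x ≤ f + c.length then (c.take (x - f)).any fun l => v l.1 == l.2 else v x
      with hv'
    have hv'lt : ∀ x < f, v' x = v x := fun x hx => by
      rw [hv']; simp only; rw [if_neg]; omega
    have hany : ∀ c' ∈ c :: F, (c'.any fun l => v' l.1 == l.2) = (c'.any fun l => v l.1 == l.2) :=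
      fun c' hc' => any_congr_mem fun l hl => by rw [hv'lt _ (hlt c' hc' l hl)]
    obtain ⟨w, hw, hwg⟩ := gadgets_complete F (f + c.length + 1) v'
      (fun c' hc' l hl => (hlt c' (List.mem_cons_of_mem _ hc') l hl).trans_le (by omega))
      (fun c' hc' => by rw [hany c' (List.mem_cons_of_mem _ hc')]; exact hsat c' (by simp [hc']))
    have hwlt : ∀ x < f, w x = v x := fun x hx => by rw [hw x (by omega), hv'lt x hx]
    refine ⟨w, hwlt, fun d hd => ?_⟩
    simp only [gadgets, List.mem_append] at hd
    rcases hd with hd | hd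
    · -- the gadget of `c`
      have hcany : (c.any fun l => w l.1 == l.2) = (c.any fun l => v l.1 == l.2) :=
        any_congr_mem fun l hl => by rw [hwlt _ (hlt c List.mem_cons_self l hl)]
      have htake : ∀ i, ((c.take i).any fun l => w l.1 == l.2) =
          ((c.take i).any fun l => v l.1 == l.2) := fun i =>
        any_congr_mem fun l hl => by
          rw [hwlt _ (hlt c List.mem_cons_self l (List.mem_of_mem_take hl))]
      have H : ∀ i ≤ c.length, w (f + i) = (false || (c.take i).any fun l => w l.1 == l.2) := by
        intro i hi
        rw [Bool.false_or, htake, hw (f + i) (by omega), hv']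
        simp [hi]
      simp only [gadget, List.mem_cons, List.mem_append, List.not_mem_nil, or_false] at hd
      rcases hd with rfl | hd | rfl
      · have := H 0 (Nat.zero_le _)
        simp only [Nat.add_zero, List.take_zero, List.any_nil, Bool.or_false] at this
        simp [this]
      · exact chain_complete w f c false H d hd
      · have := H c.length le_rfl
        rw [List.take_length, Bool.false_or, hcany, hsat c List.mem_cons_self] at this
        simp [this]
    · exact hwg d hd

end Semantics

/-- **The width reduction preserves satisfiability** (Impagliazzo–Paturi–Zane 2001, Lemma 10:
the reduction is a many-one reduction from `k`-SAT to 3-SAT). [cite: ImpagliazzoPaturiZaneJCSS2001, Lemma 10 (p. 525)] -/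
theorem satisfiable_toThreeCNF_iff (φ : KCNF k) : φ.toThreeCNF.Satisfiable ↔ φ.Satisfiable := by
  rw [IPRename.satisfiable_iff_exists, IPRename.satisfiable_iff_exists]
  simp only [eval, List.all_eq_true, clauses_toThreeCNF]
  constructor
  · rintro ⟨w, hw⟩
    exact ⟨w, gadgets_sound w φ.numVars φ.clauses hw⟩
  · rintro ⟨v, hv⟩
    obtain ⟨w, -, hw⟩ := gadgets_complete φ.clauses φ.numVars v φ.fst_lt_numVars hv
    exact ⟨w, hw⟩

/-- In particular the decision bits agree. [folklore] -/
theorem decide_satisfiable_toThreeCNF (φ : KCNF k) :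
    decide φ.toThreeCNF.Satisfiable = decide φ.Satisfiable := by
  rw [decide_eq_decide]; exact satisfiable_toThreeCNF_iff φ

end KCNF

namespace WidthReduction

open _root_.Computability Complexity Complexity.ACom Sparsifier Compaction

/-! ### Emitting a counter literal and a unit clause -/

/-- `emitLit b`: push the literal `(cnt, b)` with its closing comma, in reading order, onto `acc`
(for `cnt = bits m` this prepends `(encodeLiteral (m, b)).reverse`). Requires
`j1 = j2 = j3 = []`. [folklore] -/
def emitLit (b : Bool) : Prog :=
  push K.acc (Γ'.bit b) ;; emitCnt K.acc ;; push K.acc Γ'.comma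

/-- **Specification of `emitLit`.** [folklore] -/
theorem runs_emitLit (b : Bool) (m : ℕ) (R : Store) (hcnt : R K.cnt = bits m)
    (hj1 : R K.j1 = []) (hj2 : R K.j2 = []) (hj3 : R K.j3 = []) :
    Runs (emitLit b) R
      (Function.update R K.acc ((KCNF.encodeLiteral (m, b)).reverse ++ R K.acc))
      (13 * (bits m).length + 6) := by
  unfold emitLit
  have e1 := Runs.push K.acc (Γ'.bit b) R
  set R₁ := Function.update R K.acc (Γ'.bit b :: R K.acc) with hR₁
  have e2 := runs_emitCnt (dst := K.acc) (by decide) (by decide) (by decide) (by decide) R₁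
    (by simp [hR₁, hj1]) (by simp [hR₁, hj2]) (by simp [hR₁, hj3])
  have h2 : R₁ K.cnt = bits m := by simp [hR₁, hcnt]
  have h2' : R₁ K.acc = Γ'.bit b :: R K.acc := by simp [hR₁]
  rw [h2, h2'] at e2
  set R₂ := Function.update R₁ K.acc ((bits m).reverse ++ Γ'.bit b :: R K.acc) with hR₂
  have e3 := Runs.push K.acc Γ'.comma R₂
  refine (e1.seq (e2.seq e3)).of_eq ?_ (by omega)
  rw [hR₂, hR₁]
  simp only [Function.update_idem, Function.update_self, encodeLiteral_eq, litBody_eq,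
    List.reverse_append, List.reverse_cons, List.reverse_nil, List.nil_append,
    List.append_assoc, List.cons_append]

/-- `unitCl b`: push the unit clause `[(cnt, b)]` (with its brackets) onto `acc`. Requires
`j1 = j2 = j3 = []`. [folklore] -/
def unitCl (b : Bool) : Prog :=
  push K.acc Γ'.bra ;; emitLit b ;; push K.acc Γ'.ket

/-- **Specification of `unitCl`.** [folklore] -/
theorem runs_unitCl (b : Bool) (m : ℕ) (R : Store) (hcnt : R K.cnt = bits m)
    (hj1 : R K.j1 = []) (hj2 : R K.j2 = []) (hj3 : R K.j3 = []) :
    Runs (unitCl b) R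
      (Function.update R K.acc ((KCNF.encodeClause [(m, b)]).reverse ++ R K.acc))
      (13 * (bits m).length + 8) := by
  unfold unitCl
  have e1 := Runs.push K.acc Γ'.bra R
  set R₁ := Function.update R K.acc (Γ'.bra :: R K.acc) with hR₁
  have e2 := runs_emitLit b m R₁ (by simp [hR₁, hcnt]) (by simp [hR₁, hj1]) (by simp [hR₁, hj2])
    (by simp [hR₁, hj3])
  have h2 : R₁ K.acc = Γ'.bra :: R K.acc := by simp [hR₁]
  rw [h2] at e2
  set R₂ := Function.update R₁ K.acc ((KCNF.encodeLiteral (m, b)).reverse ++ Γ'.bra :: R K.acc)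
    with hR₂
  have e3 := Runs.push K.acc Γ'.ket R₂
  refine (e1.seq (e2.seq e3)).of_eq ?_ (by omega)
  rw [hR₂, hR₁]
  simp only [Function.update_idem, Function.update_self, encodeClause_eq, cbody_cons, cbody_nil,
    encodeLiteral_eq, List.reverse_append, List.reverse_cons, List.reverse_nil, List.nil_append,
    List.append_assoc, List.cons_append]

/-! ### Processing one literal -/

/-- `litAct`: the action at a literal `l` of a clause (accumulated reversed in `x`): emit the
chain clause `[(cnt, true), l, (cnt + 1, false)]` onto `acc`, the counter being incremented in
between. Requires `j1 = j2 = j3 = fl = []`. [folklore] -/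
def litAct : Prog :=
  push K.acc Γ'.bra ;; emitLit true ;; pour K.x K.j1 ;; pour K.j1 K.acc ;;
  push K.acc Γ'.comma ;; incr ;; emitLit false ;; push K.acc Γ'.ket

/-- Cost of `litAct` when the literal and both counter numerals have length `≤ W`. [folklore] -/
def cLitAct (W : ℕ) : ℕ := 41 * W + 26

/-- **Specification of `litAct`.** [folklore] -/
theorem runs_litAct (l : Lit) (m W : ℕ) (R : Store) (hx : R K.x = (litBody l).reverse)
    (hcnt : R K.cnt = bits m) (hj1 : R K.j1 = []) (hj2 : R K.j2 = []) (hj3 : R K.j3 = [])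
    (hfl : R K.fl = []) (hl : (litBody l).length ≤ W) (hm : (bits m).length ≤ W)
    (hm1 : (bits (m + 1)).length ≤ W) :
    Runs litAct R
      (Function.update (Function.update (Function.update R K.x []) K.cnt (bits (m + 1))) K.acc
        ((KCNF.encodeClause [(m, true), l, (m + 1, false)]).reverse ++ R K.acc))
      (cLitAct W) := by
  unfold litAct
  -- `[` and `(m, true),`
  have e1 := Runs.push K.acc Γ'.bra R
  set R₁ := Function.update R K.acc (Γ'.bra :: R K.acc) with hR₁
  have e2 := runs_emitLit true m R₁ (by simp [hR₁, hcnt]) (by simp [hR₁, hj1])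
    (by simp [hR₁, hj2]) (by simp [hR₁, hj3])
  have h2 : R₁ K.acc = Γ'.bra :: R K.acc := by simp [hR₁]
  rw [h2] at e2
  set A₂ := (KCNF.encodeLiteral (m, true)).reverse ++ Γ'.bra :: R K.acc with hA₂
  set R₂ := Function.update R₁ K.acc A₂ with hR₂
  -- the literal `l,`
  have e3 := runs_pour (a := K.x) (b := K.j1) (by decide) R₂
  have h3a : R₂ K.x = (litBody l).reverse := by simp [hR₂, hR₁, hx]
  have h3b : R₂ K.j1 = [] := by simp [hR₂, hR₁, hj1]
  rw [h3a, h3b, List.reverse_reverse, List.append_nil, List.length_reverse] at e3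
  set R₃ := Function.update (Function.update R₂ K.x []) K.j1 (litBody l) with hR₃
  have e4 := runs_pour (a := K.j1) (b := K.acc) (by decide) R₃
  have h4a : R₃ K.j1 = litBody l := by simp [hR₃]
  have h4b : R₃ K.acc = A₂ := by simp [hR₃, hR₂]
  rw [h4a, h4b] at e4
  set R₄ := Function.update (Function.update R₃ K.j1 []) K.acc ((litBody l).reverse ++ A₂) with hR₄
  have e5 := Runs.push K.acc Γ'.comma R₄
  have h5 : R₄ K.acc = (litBody l).reverse ++ A₂ := by simp [hR₄]
  rw [h5] at e5
  set R₅ := Function.update R₄ K.acc (Γ'.comma :: ((litBody l).reverse ++ A₂)) with hR₅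
  -- the counter
  have e6 := runs_incr (encodeNat m) R₅ (by simp [hR₅, hR₄, hR₃, hR₂, hR₁, hcnt, bits_eq_bw])
    (by simp [hR₅, hR₄, hR₃, hR₂, hR₁, hfl]) (by simp [hR₅, hR₄, hR₃, hR₂, hR₁])
  rw [← TokConv.encodeNat_succ_eq_incRes, ← bits_eq_bw] at e6
  set R₆ := Function.update R₅ K.cnt (bits (m + 1)) with hR₆
  -- `(m + 1, false),` and `]`
  have e7 := runs_emitLit false (m + 1) R₆ (by simp [hR₆]) (by simp [hR₆, hR₅, hR₄, hR₃])
    (by simp [hR₆, hR₅, hR₄, hR₃, hR₂, hR₁, hj2]) (by simp [hR₆, hR₅, hR₄, hR₃, hR₂, hR₁, hj3])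
  have h7 : R₆ K.acc = Γ'.comma :: ((litBody l).reverse ++ A₂) := by simp [hR₆, hR₅]
  rw [h7] at e7
  set R₇ := Function.update R₆ K.acc ((KCNF.encodeLiteral (m + 1, false)).reverse ++
    Γ'.comma :: ((litBody l).reverse ++ A₂)) with hR₇
  have e8 := Runs.push K.acc Γ'.ket R₇
  refine (e1.seq (e2.seq (e3.seq (e4.seq (e5.seq (e6.seq (e7.seq e8))))))).of_eq ?_ ?_
  · rw [hR₇, hR₆, hR₅, hR₄, hR₃, hR₂, hR₁, hA₂]
    have eacc : Γ'.ket :: ((KCNF.encodeLiteral (m + 1, false)).reverse ++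
        Γ'.comma :: ((litBody l).reverse ++
          ((KCNF.encodeLiteral (m, true)).reverse ++ Γ'.bra :: R K.acc))) =
        (KCNF.encodeClause [(m, true), l, (m + 1, false)]).reverse ++ R K.acc := by
      simp [encodeClause_eq, cbody_cons, encodeLiteral_eq]
    funext r
    rcases eq_or_ne r K.acc with rfl | h0
    · simp [eacc]
    rcases eq_or_ne r K.cnt with rfl | h1
    · simp
    rcases eq_or_ne r K.x with rfl | h2'
    · simp
    rcases eq_or_ne r K.j1 with rfl | h3'
    · simp [hj1]
    simp [h0, h1, h2', h3']
  · have := TokConv.length_encodeNat_le m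
    have hbm : (encodeNat m).length = (bits m).length := by simp [bits]
    simp only [cLitAct]
    omega

/-! ### Processing one clause -/

/-- `clauseAct`: the action at a clause `c` of the input (its body accumulated reversed in
`cacc`), the counter holding `f`: emit the unit clause `[(f, false)]`, the chain clauses of the
literals (counter `f ↦ f + |c|`), the unit clause `[(f + |c|, true)]`, and increment the counter —
the gadget `KCNF.gadget f c`, the counter ending at `f + |c| + 1`. [folklore] -/
def clauseAct : Prog :=
  unitCl false ;; pour K.cacc K.c ;; loop K.c (litPass K.c2 K.x litAct) ;; clear K.c2 ;;
  unitCl true ;; incr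

/-- Cost of `clauseAct` for a clause body of length `≤ Wc` and numerals of length `≤ W`.
[folklore] -/
def cClause (W Wc : ℕ) : ℕ := (4 * W + cLitAct W + 3) * Wc + 5 * Wc + 35 * W + 28

/-- The scratch registers used by the routines are empty. [folklore] -/
structure Scr (R : Store) : Prop where
  j1 : R K.j1 = []
  j2 : R K.j2 = []
  j3 : R K.j3 = []
  fl : R K.fl = []

/-- The store during the pass over a clause body started with counter `f`, after the literals
`done`: `acc` has received the chain clauses of `done`, the counter is `f + |done|`.
[folklore] -/
def StL (B : Store) (f : ℕ) (done rest : List Lit) : Store :=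
  Function.update (Function.update (Function.update (Function.update B
    K.c (cbody rest)) K.c2 ((cbody done).reverse ++ B K.c2))
    K.acc ((wFam (KCNF.chain f done)).reverse ++ B K.acc))
    K.cnt (bits (f + done.length))

/-- **The pass over a clause body**: from counter `f`, the chain clauses `KCNF.chain f c₀` are
emitted and the counter ends at `f + |c₀|`, provided all literals and all counter numerals
`bits (f + i)`, `i ≤ |c₀|`, have length `≤ W`. [folklore] -/
theorem runs_litLoop (f : ℕ) (c₀ : List Lit) (W : ℕ) (hW : ∀ l ∈ c₀, (litBody l).length ≤ W)
    (hWf : ∀ i ≤ c₀.length, (bits (f + i)).length ≤ W)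
    (B : Store) (hS : Scr B) (hc : B K.c = cbody c₀) (hc2 : B K.c2 = []) (hx : B K.x = [])
    (hcnt : B K.cnt = bits f) :
    Runs (loop K.c (litPass K.c2 K.x litAct)) B (StL B f c₀ [])
      ((4 * W + cLitAct W + 3) * c₀.length + 1) := by
  obtain ⟨hj1, hj2, hj3, hfl⟩ := hS
  have hpass := runs_litPass (reg := K.c) (sv := K.c2) (ac := K.x) litAct (by decide)
    (by decide) (by decide) (StL B f) c₀ W (cLitAct W)
    (fun done rest => by simp [StL])
    (fun done rest => by simp [StL, hx])
    (fun done l rest hsplit hl => by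
      have hdl : done.length + 1 ≤ c₀.length := by
        rw [← hsplit]; simp
      set P := litPre K.c K.c2 K.x (StL B f done (l :: rest)) l rest with hP
      have e := runs_litAct l (f + done.length) W P (by simp [hP, litPre, StL, hx])
        (by simp [hP, litPre, StL]) (by simp [hP, litPre, StL, hj1])
        (by simp [hP, litPre, StL, hj2]) (by simp [hP, litPre, StL, hj3])
        (by simp [hP, litPre, StL, hfl]) hl (hWf _ (by omega))
        (by rw [Nat.add_assoc]; exact hWf _ hdl)
      refine e.of_eq ?_ le_rfl
      rw [hP]
      simp only [litPre, StL, KCNF.chain_append, KCNF.chain, wFam_append, wFam_cons, wFam_nil,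
        cbody_append, cbody_cons, cbody_nil, encodeClause_eq,
        List.reverse_append, List.length_append, List.length_cons, List.length_nil, Nat.add_assoc]
      funext r; cases r <;> simp [hx])
    c₀ [] rfl hW
  have hSt0 : StL B f [] c₀ = B := by
    funext r; cases r <;> simp [StL, hc, hc2, hcnt, KCNF.chain]
  rw [hSt0, List.nil_append] at hpass
  exact hpass

/-- The store during the pass over the clauses (first fresh variable `n`), after the clauses
`done`: `acc` has received `wFam (gadgets n done)`, the counter is `freshAfter n done`.
[folklore] -/
def StF (B : Store) (n : ℕ) (done rest : List (List Lit)) : Store :=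
  Function.update (Function.update (Function.update (Function.update B
    K.inp (wFam rest)) K.raw ((wFam done).reverse ++ B K.raw))
    K.acc ((wFam (KCNF.gadgets n done)).reverse ++ B K.acc))
    K.cnt (bits (KCNF.freshAfter n done))

/-- **The pass over the clauses**: the gadgets `KCNF.gadgets n F` are emitted and the counter ends
at `KCNF.freshAfter n F`, provided all clause bodies have length `≤ Wc` and all literals and all
counter numerals up to `KCNF.freshAfter n F` have length `≤ W`. [folklore] -/
theorem runs_clauseLoop (n : ℕ) (F : List (List Lit)) (W Wc : ℕ)
    (hWc : ∀ c ∈ F, (cbody c).length ≤ Wc) (hW : ∀ c ∈ F, ∀ l ∈ c, (litBody l).length ≤ W)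
    (hWn : ∀ v, n ≤ v → v ≤ KCNF.freshAfter n F → (bits v).length ≤ W)
    (B : Store) (hS : Scr B) (hinp : B K.inp = wFam F) (hraw : B K.raw = [])
    (hcacc : B K.cacc = []) (hc : B K.c = []) (hc2 : B K.c2 = []) (hx : B K.x = [])
    (hcnt : B K.cnt = bits n) :
    Runs (loop K.inp (famPass K.raw K.cacc clauseAct)) B (StF B n F [])
      ((4 * Wc + cClause W Wc + 6) * F.length + 1) := by
  obtain ⟨hj1, hj2, hj3, hfl⟩ := hS
  have hpass := runs_famPass (reg := K.inp) (sv := K.raw) (ca := K.cacc) clauseAct (by decide)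
    (by decide) (by decide) (StF B n) F Wc (cClause W Wc)
    (fun done rest => by simp [StF])
    (fun done rest => by simp [StF, hcacc])
    (fun done c₀ rest hsplit hcW => by
      set f := KCNF.freshAfter n done with hf
      -- counter values met inside this clause are `≤ freshAfter n F`
      have hfF : f + c₀.length + 1 ≤ KCNF.freshAfter n F := by
        rw [← hsplit, KCNF.freshAfter_append]
        show KCNF.freshAfter (KCNF.freshAfter n done) (c₀ :: rest) ≥ _
        simp only [KCNF.freshAfter, ← hf]
        exact KCNF.le_freshAfter _ _
      have hWl : ∀ l ∈ c₀, (litBody l).length ≤ W := fun l hl => hW c₀ (by rw [← hsplit]; simp) l hl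
      set P := famPre K.inp K.raw K.cacc (StF B n done (c₀ :: rest)) c₀ rest with hP
      unfold clauseAct
      -- the unit clause `[(f, false)]`
      have e1 := runs_unitCl false f P (by simp [hP, famPre, StF, hf]) (by simp [hP, famPre, StF, hj1])
        (by simp [hP, famPre, StF, hj2]) (by simp [hP, famPre, StF, hj3])
      set P₁ := Function.update P K.acc ((KCNF.encodeClause [(f, false)]).reverse ++ P K.acc) with hP₁
      -- the body in reading order
      have e2 := runs_pour (a := K.cacc) (b := K.c) (by decide) P₁
      have h2a : P₁ K.cacc = (cbody c₀).reverse := by simp [hP₁, hP, famPre, StF, hcacc]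
      have h2b : P₁ K.c = [] := by simp [hP₁, hP, famPre, StF, hc]
      rw [h2a, h2b, List.length_reverse, List.reverse_reverse, List.append_nil] at e2
      set P₂ := Function.update (Function.update P₁ K.cacc []) K.c (cbody c₀) with hP₂
      -- the literals
      have hnf : n ≤ f := KCNF.le_freshAfter n done
      have e3 := runs_litLoop f c₀ W hWl (fun i hi => hWn _ (by omega) (by omega)) P₂
        ⟨by simp [hP₂, hP₁, hP, famPre, StF, hj1], by simp [hP₂, hP₁, hP, famPre, StF, hj2],
         by simp [hP₂, hP₁, hP, famPre, StF, hj3], by simp [hP₂, hP₁, hP, famPre, StF, hfl]⟩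
        (by simp [hP₂]) (by simp [hP₂, hP₁, hP, famPre, StF, hc2])
        (by simp [hP₂, hP₁, hP, famPre, StF, hx]) (by simp [hP₂, hP₁, hP, famPre, StF, hf])
      set P₃ := StL P₂ f c₀ [] with hP₃
      -- drop the saved body
      have e4 := runs_clear K.c2 P₃
      have h4 : P₃ K.c2 = (cbody c₀).reverse := by
        simp [hP₃, StL, hP₂, hP₁, hP, famPre, StF, hc2]
      rw [h4, List.length_reverse] at e4
      set P₄ := Function.update P₃ K.c2 [] with hP₄
      -- the unit clause `[(f + |c₀|, true)]`
      have e5 := runs_unitCl true (f + c₀.length) P₄ (by simp [hP₄, hP₃, StL])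
        (by simp [hP₄, hP₃, StL, hP₂, hP₁, hP, famPre, StF, hj1])
        (by simp [hP₄, hP₃, StL, hP₂, hP₁, hP, famPre, StF, hj2])
        (by simp [hP₄, hP₃, StL, hP₂, hP₁, hP, famPre, StF, hj3])
      set P₅ := Function.update P₄ K.acc ((KCNF.encodeClause [(f + c₀.length, true)]).reverse ++
        P₄ K.acc) with hP₅
      -- the counter
      have e6 := runs_incr (encodeNat (f + c₀.length)) P₅
        (by simp [hP₅, hP₄, hP₃, StL, bits_eq_bw])
        (by simp [hP₅, hP₄, hP₃, StL, hP₂, hP₁, hP, famPre, StF, hfl])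
        (by simp [hP₅, hP₄, hP₃, StL, hP₂, hP₁, hP, famPre, StF, hj1])
      rw [← TokConv.encodeNat_succ_eq_incRes, ← bits_eq_bw] at e6
      refine (e1.seq (e2.seq (e3.seq (e4.seq (e5.seq e6))))).of_eq ?_ ?_
      · rw [hP₅, hP₄, hP₃, hP₂, hP₁, hP]
        simp only [famPre, StF, StL, KCNF.gadgets_append, KCNF.gadgets, KCNF.gadget,
          KCNF.freshAfter_append, KCNF.freshAfter, List.append_nil, wFam_append, wFam_cons,
          wFam_nil, List.reverse_append, List.reverse_cons, List.append_assoc, List.nil_append,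
          List.cons_append, ← hf, encodeClause_eq]
        funext r; cases r <;> simp [hcacc, hc, hc2, cbody]
      · have h1 := length_le_length_cbody c₀
        have h2 := hWn f hnf (by omega)
        have h3 := hWn (f + c₀.length) (by omega) (by omega)
        have h4 := TokConv.length_encodeNat_le (f + c₀.length)
        have h5 : (encodeNat (f + c₀.length)).length = (bits (f + c₀.length)).length := by
          simp [bits]
        simp only [cClause]
        nlinarith [hcW])
    F [] rfl hWc
  have hSt0 : StF B n [] F = B := by
    funext r; cases r <;> simp [StF, hinp, hraw, hcnt, KCNF.gadgets, KCNF.freshAfter, wFam]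
  rw [hSt0, List.nil_append] at hpass
  exact hpass

/-! ### The program -/

/-- The body of the outer loop over the input: header digits are collected on `j1`; at the comma
closing the header they are poured into the counter `cnt` (`bits n`, the first fresh variable),
the clauses are processed and the output is written. [folklore] -/
def hdrBody (a : Γ') : Prog :=
  match a with
  | Γ'.comma => pour K.j1 K.cnt ;; loop K.inp (famPass K.raw K.cacc clauseAct) ;; finish
  | _ => push K.j1 a

/-- **The width-reduction program.** [folklore] -/
def prog : Prog := loop K.inp hdrBody

/-- The header digits are collected (reversed) on `j1`. [folklore] -/
theorem segRuns_header : ∀ (u w : List Bool) (v : List Γ'),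
    SegRuns K.inp hdrBody (bw u)
      (Function.update (AStore.single K.inp (bw u ++ v)) K.j1 (bw w))
      (Function.update (AStore.single K.inp v) K.j1 ((bw u).reverse ++ bw w))
      (3 * u.length)
  | [], w, v => by
    simpa using SegRuns.nil K.inp hdrBody (Function.update (AStore.single K.inp v) K.j1 (bw w))
  | b :: u, w, v => by
    have hk : Function.update (AStore.single K.inp (bw (b :: u) ++ v)) K.j1 (bw w) K.inp =
        Γ'.bit b :: (bw u ++ v) := by simp
    have hbody : Runs (hdrBody (Γ'.bit b))
        (Function.update (Function.update (AStore.single K.inp (bw (b :: u) ++ v)) K.j1 (bw w))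
          K.inp (bw u ++ v))
        (Function.update (AStore.single K.inp (bw u ++ v)) K.j1 (bw (b :: w))) 1 := by
      refine Runs.push' ?_
      funext r; cases r <;> simp [AStore.single]
    have ih := segRuns_header u (b :: w) v
    have := SegRuns.cons hk hbody ih
    refine this.of_eq ?_ (by simp only [List.length_cons]; omega)
    simp

/-- Cost of the program on a formula of encoded length `L`. [folklore] -/
def cProg (L : ℕ) : ℕ :=
  3 * L + (3 * L + 1 + ((4 * L + cClause (2 * L + 3) L + 6) * L + 1) +
    (2 * L + 3 * (L * (3 * (2 * L + 3) + 5)) + 6 * (2 * L + 3) + 6)) + 2 + 1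

/-! ### Sizes -/

/-- Incrementing a numeral adds at most one digit each time:
`|bits (n + j)| ≤ |bits n| + j`. [folklore] -/
theorem length_bits_add_le (n : ℕ) : ∀ j : ℕ, (bits (n + j)).length ≤ (bits n).length + j
  | 0 => by simp
  | j + 1 => by
    have h1 := length_bits_add_le n j
    have h2 := TokConv.length_incRes_le true (encodeNat (n + j))
    rw [← TokConv.encodeNat_succ_eq_incRes] at h2
    simp only [bits, List.length_map] at h1 h2 ⊢
    rw [← Nat.add_assoc]
    omega

/-- The fresh variables fit: `freshAfter n F ≤ n + |wFam F|`. [folklore] -/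
theorem freshAfter_le (n : ℕ) (F : List (List Lit)) :
    KCNF.freshAfter n F ≤ n + (wFam F).length := by
  rw [KCNF.freshAfter_eq, length_wFam]
  refine Nat.add_le_add_left (List.sum_le_sum fun c _ => ?_) _
  have := length_le_length_cbody c
  omega

/-- The length of the produced family word: at most `|F|_{clauses+2} · (3 W + 5)`, i.e. every
produced clause has at most three literals of length `≤ W` each. [folklore] -/
theorem length_wFam_gadgets_le (n : ℕ) (F : List (List Lit)) (W : ℕ)
    (hW : ∀ c ∈ F, ∀ l ∈ c, (litBody l).length ≤ W)
    (hWn : ∀ v, n ≤ v → v ≤ KCNF.freshAfter n F → (bits v).length + 1 ≤ W) :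
    (wFam (KCNF.gadgets n F)).length ≤ (KCNF.gadgets n F).length * (3 * W + 5) := by
  rw [length_wFam]
  have key : ∀ d ∈ KCNF.gadgets n F, (cbody d).length + 2 ≤ 3 * W + 5 := by
    intro d hd
    obtain ⟨hlen, hlit⟩ := KCNF.mem_gadgets hd
    have hl : ∀ l ∈ d, (litBody l).length ≤ W := by
      intro l hl
      rcases hlit l hl with ⟨c, hc, hlc⟩ | ⟨h1, h2⟩
      · exact hW c hc l hlc
      · have := hWn l.1 h1 h2.le
        rw [litBody_eq]; simp only [List.length_cons]; omega
    rw [length_cbody]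
    have : (d.map fun l => (bits l.1).length + 2).sum ≤ d.length * (W + 1) := by
      have := List.sum_le_card_nsmul (d.map fun l => (bits l.1).length + 2) (W + 1) (by
        intro x hx
        obtain ⟨l, hl', rfl⟩ := List.mem_map.1 hx
        have := hl l hl'
        rw [litBody_eq] at this; simp only [List.length_cons] at this; omega)
      simpa using this
    nlinarith
  have := List.sum_le_card_nsmul ((KCNF.gadgets n F).map fun c => (cbody c).length + 2)
    (3 * W + 5) (by
      intro x hx
      obtain ⟨d, hd, rfl⟩ := List.mem_map.1 hx
      exact key d hd)
  simpa using this

/-- The number of produced clauses: `Σ (|c| + 2) ≤ |wFam F|`. [folklore] -/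
theorem length_gadgets_le (n : ℕ) (F : List (List Lit)) :
    (KCNF.gadgets n F).length ≤ (wFam F).length := by
  rw [KCNF.length_gadgets, length_wFam]
  exact List.sum_le_sum fun c _ => Nat.add_le_add_right (length_le_length_cbody c) 2

/-! ### The run of the program -/

/-- **The run of the width-reduction program**: from the encoding of `φ` in `inp` to the encoding
of `φ.toThreeCNF` in `out`, all other registers empty, within `cProg L` steps. [folklore] -/
theorem runs_prog {k : ℕ} (φ : KCNF k) :
    Runs prog (AStore.single K.inp φ.encode) (AStore.single K.out φ.toThreeCNF.encode)
      (cProg φ.encode.length) := by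
  set F := φ.clauses with hF
  set n := φ.numVars with hn
  set L := φ.encode.length with hL
  have hLeq : L = (bits n).length + 1 + (wFam F).length := by
    rw [hL, encode_eq]; simp only [List.length_append, List.length_cons, hF, hn]; omega
  have hwf : (wFam F).length ≤ L := by omega
  -- size assumptions
  set W := 2 * L + 3 with hWdef
  have hWc : ∀ c ∈ F, (cbody c).length ≤ L := fun c hc => by
    have := length_cbody_le_wFam hc; omega
  have hWl : ∀ c ∈ F, ∀ l ∈ c, (litBody l).length ≤ W := fun c hc l hl => by
    have h1 := length_bits_le_wFam (List.mem_flatten.2 ⟨c, hc, hl⟩)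
    rw [litBody_eq]; simp only [List.length_cons]; omega
  have hWn : ∀ v, n ≤ v → v ≤ KCNF.freshAfter n F → (bits v).length + 1 ≤ W := fun v hnv hv => by
    have h1 := freshAfter_le n F
    obtain ⟨j, rfl⟩ := Nat.exists_eq_add_of_le hnv
    have h2 := length_bits_add_le n j
    omega
  have hq : F.length ≤ L := (length_le_wFam F).trans hwf
  unfold prog
  -- the header
  have hseg1 := segRuns_header (encodeNat n) [] (Γ'.comma :: wFam F)
  rw [← bits_eq_bw] at hseg1
  simp only [bw_nil, List.append_nil] at hseg1
  have e0 : Function.update (AStore.single K.inp (bits n ++ Γ'.comma :: wFam F)) K.j1 [] =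
      AStore.single K.inp (bits n ++ Γ'.comma :: wFam F) := by
    funext r; cases r <;> simp [AStore.single]
  rw [e0] at hseg1
  -- at the comma: the counter
  set S₁ : Store := Function.update (AStore.single K.inp (Γ'.comma :: wFam F)) K.j1 (bits n).reverse
    with hS₁
  have ep := runs_pour (a := K.j1) (b := K.cnt) (by decide) (Function.update S₁ K.inp (wFam F))
  have hp1 : Function.update S₁ K.inp (wFam F) K.j1 = (bits n).reverse := by simp [hS₁]
  have hp2 : Function.update S₁ K.inp (wFam F) K.cnt = [] := by simp [hS₁, AStore.single]
  rw [hp1, hp2, List.reverse_reverse, List.append_nil, List.length_reverse] at ep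
  set B₀ : Store := Function.update (AStore.single K.inp (wFam F)) K.cnt (bits n) with hB₀
  have eB₀ : Function.update (Function.update (Function.update S₁ K.inp (wFam F)) K.j1 []) K.cnt
      (bits n) = B₀ := by
    rw [hB₀, hS₁]; funext r; cases r <;> simp [AStore.single]
  rw [eB₀] at ep
  -- the clauses and the output
  have hS : Scr B₀ := ⟨by simp [hB₀, AStore.single], by simp [hB₀, AStore.single],
    by simp [hB₀, AStore.single], by simp [hB₀, AStore.single]⟩
  have e1 := runs_clauseLoop n F W L hWc hWl (fun v h1 h2 => by have := hWn v h1 h2; omega) B₀ hS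
    (by simp [hB₀]) (by simp [hB₀, AStore.single]) (by simp [hB₀, AStore.single])
    (by simp [hB₀, AStore.single]) (by simp [hB₀, AStore.single]) (by simp [hB₀, AStore.single])
    (by simp [hB₀])
  have e2 := runs_finish (StF B₀ n F []) (by simp [StF, hB₀, AStore.single])
    (by simp [StF, hB₀, AStore.single])
  have hbody : Runs (hdrBody Γ'.comma) (Function.update S₁ K.inp (wFam F))
      (AStore.single K.out φ.toThreeCNF.encode)
      ((3 * (bits n).length + 1) +
        (((4 * L + cClause W L + 6) * F.length + 1) +
        (2 * (StF B₀ n F [] K.raw).length + 2 * (StF B₀ n F [] K.d).length +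
          3 * (StF B₀ n F [] K.acc).length + 6 * (StF B₀ n F [] K.cnt).length + 6))) := by
    unfold hdrBody
    refine (ep.seq (e1.seq e2)).of_eq ?_ le_rfl
    rw [hB₀]
    have eout : φ.toThreeCNF.encode = bits (KCNF.freshAfter n F) ++ Γ'.comma ::
        wFam (KCNF.gadgets n F) := by
      rw [encode_eq]; rfl
    rw [eout]
    simp only [StF]
    funext r; cases r <;> simp [AStore.single, wFam]
  have hk : S₁ K.inp = Γ'.comma :: wFam F := by simp [hS₁]
  have hseg2 := SegRuns.single (f := hdrBody) (R := S₁) (a := Γ'.comma) (w := wFam F) hk hbody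
  have hall := (hseg1.append hseg2).runs_loop_nil (by simp [AStore.single])
  rw [encode_eq, ← hF, ← hn]
  refine hall.mono ?_
  -- the cost
  have hbn : (bits n).length ≤ L := by omega
  have hraw : (StF B₀ n F [] K.raw).length ≤ L := by simp [StF, hB₀, AStore.single]; omega
  have hd : (StF B₀ n F [] K.d).length = 0 := by simp [StF, hB₀, AStore.single]
  have hacc : (StF B₀ n F [] K.acc).length ≤ L * (3 * W + 5) := by
    have h1 : (StF B₀ n F [] K.acc).length = (wFam (KCNF.gadgets n F)).length := by
      simp [StF, hB₀, AStore.single]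
    rw [h1]
    refine (length_wFam_gadgets_le n F W hWl hWn).trans ?_
    exact Nat.mul_le_mul_right _ ((length_gadgets_le n F).trans hwf)
  have hcnt : (StF B₀ n F [] K.cnt).length ≤ W := by
    have h1 : (StF B₀ n F [] K.cnt).length = (bits (KCNF.freshAfter n F)).length := by simp [StF]
    rw [h1]; have := hWn _ (KCNF.le_freshAfter n F) le_rfl; omega
  have hbits : (encodeNat n).length = (bits n).length := by simp [bits]
  have hcl : (4 * L + cClause W L + 6) * F.length + 1 ≤ (4 * L + cClause W L + 6) * L + 1 := by
    have := Nat.mul_le_mul_left (4 * L + cClause W L + 6) hq; omega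
  simp only [cProg, ← hWdef]
  omega

/-- **The running time is polynomial**: `cProg L + 1 ≤ 100 (L + 1)^3`. [folklore] -/
theorem cProg_le (L : ℕ) : cProg L + 1 ≤ 100 * (L + 1) ^ 3 := by
  have e : cProg L = 90 * L ^ 3 + 261 * L ^ 2 + 201 * L + 29 := by
    simp only [cProg, cClause, cLitAct]; ring
  rw [e]
  have e2 : 100 * (L + 1) ^ 3 = 100 * L ^ 3 + 300 * L ^ 2 + 300 * L + 100 := by ring
  rw [e2]
  have := Nat.zero_le (L ^ 3); have := Nat.zero_le (L ^ 2)
  omega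

/-- **The width reduction is computable in polynomial time**: some multi-stack machine maps
`φ.encode` to `φ.toThreeCNF.encode` within `100 (L + 1)^3` steps. [folklore] -/
theorem computesInTime_toThreeCNF (k : ℕ) :
    Literature.Computability.FineGrained.ComputesInTime KCNF.encode KCNF.encode
      (KCNF.toThreeCNF : KCNF k → KCNF 3) fun φ => 100 * (φ.encode.length + 1) ^ 3 := by
  obtain ⟨M, hM⟩ := ACom.exists_computesInTime prog K.inp K.out KCNF.encode KCNF.encode
    (KCNF.toThreeCNF : KCNF k → KCNF 3) (fun φ => cProg φ.encode.length) (fun φ => runs_prog φ)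
  refine ⟨M, fun φ => ?_⟩
  exact ⟨⟨(Classical.choice (hM φ)).toEvalsTo, le_trans (Classical.choice (hM φ)).steps_le_m
    (cProg_le _)⟩⟩

end WidthReduction

/-! ### The reduction is polynomial-time computable -/

/-- **The width reduction is computable in polynomial time** (Impagliazzo–Paturi–Zane 2001,
Lemma 10: a *strong many-one reduction*; here on multi-stack Turing machines, `Turing.FinTM2`):
for every `k` some machine maps `KCNF.encode φ` to `KCNF.encode φ.toThreeCNF` within
`c · (L + 1)^c` steps (`c = 100 ≥ 3`: the compiled stack program `WidthReduction.prog`).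
[cite: ImpagliazzoPaturiZaneJCSS2001, Lemma 10 (p. 525)] -/
theorem KCNF.toThreeCNF_computable (k : ℕ) :
    ∃ c : ℕ, ComputesInTime KCNF.encode KCNF.encode (KCNF.toThreeCNF : KCNF k → KCNF 3)
      fun φ => c * (φ.encode.length + 1) ^ c := by
  obtain ⟨M, hM⟩ := WidthReduction.computesInTime_toThreeCNF k
  refine ⟨100, M, fun φ => ?_⟩
  obtain ⟨h⟩ := hM φ
  exact ⟨⟨h.toEvalsTo, h.steps_le_m.trans (Nat.mul_le_mul_left 100
    (Nat.pow_le_pow_right (Nat.succ_pos _) (by norm_num)))⟩⟩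

end Literature.Computability.FineGrained
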